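import Summits.AtomisticToContinuum.BoseEinsteinCondensation.Theses.BECModePrice
import Literature.MathematicalPhysics.QuantumManyBody.PeriodicBoseGasFracEnergy
import HarnessLib

/-!
# Ideator k5 (gen 6) sketch — crux `ModePriceHardCore` (stmt-AtomisticToContinuum-18513)

Route-level record for the tenure planner (see `MEMO-r6-k5.md`); nothing here is a line toward the
crux as typed.  Kernel-checked content:

* `NearGroundStateModeBound` — the **λ = 0 endpoint** of the single-mode softening statement (SMS):
  for every repulsive finite-range `v` there are `C, ρ₀ > 0` such that for `0 < ρ < ρ₀`, eventually
  in `N`, SOME slack `δ = δ_N > 0` (chosen after `N`) makes every `δ`-near-minimiser `Ψ` of the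
  periodic `N`-body energy on the torus of side `L = (N/ρ)^{1/3}` satisfy the exponent-2 infrared
  bound `½|2πp/L|² n_p(Ψ) ≤ Cρ` at every `p ≠ 0`.  No softened Hamiltonian, no response, no far-from-
  minimal states: a property of (near-)ground states only.  NOT vacuous: `δ := ⊤` turns the
  hypothesis into `True` and the conclusion is false for states filling the mode `p`; the junk boxes
  `E₀ = ⊤` are excluded `∀ᶠ N` by `DiluteEnergyBound`.
* `nearGroundStateModeBound_of_modePrice` — the crux pair (`ModePriceIntegrable`, `ModePriceHardCore`)
  implies it (slack `δ := Cρ`, constant `2C`): it is a WEAKENING of what the route asks.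
* `torusBEC_of_nearGroundStateModeBound` — it ALREADY feeds the landed count
  (`LaplacianModeCounting.condensate_ge_half_sq`, as in `softeningModeCount_proof`) and gives torus
  BEC `n₀ ≥ N/2` of the `δ_N`-near-minimisers, i.e. exactly the hypothesis of `BoundaryTransferWeak`
  (whose `δ` is also chosen after `N`).
* `closes_of_nearGroundStateModeBound` — hence
  `NearGroundStateModeBound → DiluteEnergyBound → BoundaryTransferWeak → BoseEinsteinCondensation`:
  the route's conclusion needs from its two open `ModePrice*` cruxes only their λ = 0 endpoint.

§V vendors VERBATIM copies of landed lemmas (the lattice bookkeeping of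
`Theorems/BECGroundStateSOSIRModeCounting.lean` §1 with its local notation spelled out,
`LaplacianModeCounting.sum_inv_norm_sq_latticeShell_le` and `LaplacianModeCounting.condensate_ge_half_sq`
of `Theorems/BECLaplacianL1ModeCountingL1.lean`, and `cellOccupation_le_of_softening` of
`Theorems/BECModePriceSofteningModeCount.lean`) because `Theorems/*` modules are not prebuilt on the
farm today (lean check rc 75 `remote:stale:…:unbuilt:…`); nothing in §V is new. For the same reason
the PROVED support `DiluteEnergyBound` (`becModePrice_diluteEnergyBound_proof`) enters as a hypothesis.
-/

noncomputable section

open MeasureTheory Filter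
open scoped ENNReal NNReal

namespace Summit.AtomisticToContinuum.BoseEinsteinCondensation.Cruxes.ModePriceHardCore.IdeatorK5g6

open Literature.MathematicalPhysics.QuantumManyBody.BoseGas
open Summit.AtomisticToContinuum.BoseEinsteinCondensation.Theses.BECModePrice
/-! ## §V Vendored landed lemmas (verbatim; see the module docstring) -/
namespace Vendored

/-- VERBATIM (notation spelled out) from `ModeCounting` (`Theorems/BECGroundStateSOSIRModeCounting.lean`). [folklore] -/
theorem mem_latticeBox {M : ℕ} {k : Fin 3 → ℤ} :
    k ∈ (Fintype.piFinset fun _ : Fin 3 => Finset.Icc (-((M : ℕ) : ℤ)) ((M : ℕ) : ℤ) :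
      Finset (Fin 3 → ℤ)) ↔ ∀ j, |k j| ≤ M := by
  simp [Fintype.mem_piFinset, abs_le]

/-- VERBATIM from `ModeCounting.card_latticeBox`. [folklore] -/
theorem card_latticeBox (M : ℕ) :
    ((Fintype.piFinset fun _ : Fin 3 => Finset.Icc (-((M : ℕ) : ℤ)) ((M : ℕ) : ℤ) :
      Finset (Fin 3 → ℤ))).card = (2 * M + 1) ^ 3 := by
  rw [Fintype.card_piFinset, Finset.prod_const, Finset.card_univ, Fintype.card_fin,
    Int.card_Icc]
  congr 1
  omega

/-- VERBATIM from `ModeCounting.latticeBox_mono`. [folklore] -/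
theorem latticeBox_mono {M M' : ℕ} (h : M ≤ M') :
    (Fintype.piFinset fun _ : Fin 3 => Finset.Icc (-((M : ℕ) : ℤ)) ((M : ℕ) : ℤ) :
      Finset (Fin 3 → ℤ)) ⊆
    (Fintype.piFinset fun _ : Fin 3 => Finset.Icc (-((M' : ℕ) : ℤ)) ((M' : ℕ) : ℤ) :
      Finset (Fin 3 → ℤ)) := fun k hk =>
  mem_latticeBox.2 fun j => ((mem_latticeBox.1 hk) j).trans (by exact_mod_cast h)

/-- VERBATIM from `ModeCounting.zero_mem_latticeBox`. [folklore] -/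
theorem zero_mem_latticeBox (M : ℕ) :
    (0 : Fin 3 → ℤ) ∈ (Fintype.piFinset fun _ : Fin 3 => Finset.Icc (-((M : ℕ) : ℤ)) ((M : ℕ) : ℤ) :
      Finset (Fin 3 → ℤ)) :=
  mem_latticeBox.2 fun j => by simp

/-- VERBATIM from `ModeCounting.eq_zero_of_mem_latticeBox_zero`. [folklore] -/
theorem eq_zero_of_mem_latticeBox_zero {k : Fin 3 → ℤ}
    (hk : k ∈ (Fintype.piFinset fun _ : Fin 3 => Finset.Icc (-((0 : ℕ) : ℤ)) ((0 : ℕ) : ℤ) :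
      Finset (Fin 3 → ℤ))) : k = 0 := by
  funext j
  simpa using (mem_latticeBox.1 hk) j

/-- VERBATIM from `ModeCounting.abs_apply_le_norm`. [folklore] -/
theorem abs_apply_le_norm (k : Fin 3 → ℤ) (j : Fin 3) : |(k j : ℝ)| ≤ ‖(fun i => (k i : ℝ))‖ := by
  simpa [Real.norm_eq_abs] using norm_le_pi_norm (fun i => (k i : ℝ)) j

/-- VERBATIM from `ModeCounting.succ_le_norm_of_not_mem_latticeBox`. [folklore] -/
theorem succ_le_norm_of_not_mem_latticeBox {M : ℕ} {k : Fin 3 → ℤ}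
    (hk : k ∉ (Fintype.piFinset fun _ : Fin 3 => Finset.Icc (-((M : ℕ) : ℤ)) ((M : ℕ) : ℤ) :
      Finset (Fin 3 → ℤ))) :
    (M : ℝ) + 1 ≤ ‖(fun i => (k i : ℝ))‖ := by
  rw [mem_latticeBox] at hk
  push Not at hk
  obtain ⟨j, hj⟩ := hk
  have h2 : (M : ℝ) + 1 ≤ |(k j : ℝ)| := by
    rw [← Int.cast_abs]
    exact_mod_cast (show (M : ℤ) + 1 ≤ |k j| from hj)
  exact h2.trans (abs_apply_le_norm k j)

/-- VERBATIM from `ModeCounting.mem_latticeBox_floor_of_norm_le`. [folklore] -/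
theorem mem_latticeBox_floor_of_norm_le {K : ℝ} {k : Fin 3 → ℤ} (hk : ‖(fun i => (k i : ℝ))‖ ≤ K) :
    k ∈ (Fintype.piFinset fun _ : Fin 3 => Finset.Icc (-((⌊K⌋₊ : ℕ) : ℤ)) ((⌊K⌋₊ : ℕ) : ℤ) :
      Finset (Fin 3 → ℤ)) := by
  refine mem_latticeBox.2 fun j => ?_
  have h1 : (((k j).natAbs : ℕ) : ℝ) ≤ K := by
    rw [Nat.cast_natAbs, Int.cast_abs]
    exact (abs_apply_le_norm k j).trans hk
  rw [Int.abs_eq_natAbs]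
  exact_mod_cast Nat.le_floor h1

/-- VERBATIM from `ModeCounting.norm_sq_le_sum_sq`: `‖k‖_∞² ≤ ∑_j k_j²`. [folklore] -/
theorem norm_sq_le_sum_sq (k : Fin 3 → ℤ) : ‖(fun i => (k i : ℝ))‖ ^ 2 ≤ ∑ j, (k j : ℝ) ^ 2 := by
  have hsum : 0 ≤ ∑ j, (k j : ℝ) ^ 2 := Finset.sum_nonneg fun j _ => sq_nonneg _
  have h1 : ‖(fun i => (k i : ℝ))‖ ≤ Real.sqrt (∑ j, (k j : ℝ) ^ 2) := by
    refine (pi_norm_le_iff_of_nonneg (Real.sqrt_nonneg _)).2 fun j => ?_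
    rw [Real.norm_eq_abs, ← Real.sqrt_sq_eq_abs]
    exact Real.sqrt_le_sqrt
      (Finset.single_le_sum (fun i _ => sq_nonneg ((k i : ℝ))) (Finset.mem_univ j))
  calc ‖(fun i => (k i : ℝ))‖ ^ 2 ≤ (Real.sqrt (∑ j, (k j : ℝ) ^ 2)) ^ 2 := by gcongr
    _ = ∑ j, (k j : ℝ) ^ 2 := Real.sq_sqrt hsum

/-- VERBATIM COPY of `LaplacianModeCounting.sum_inv_norm_sq_latticeShell_le`
(`Theorems/BECLaplacianL1ModeCountingL1.lean`): `∑_{0 < ‖k‖_∞ ≤ M} 1/‖k‖_∞² ≤ 26 M` on `ℤ³`.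
[cite: KLS1988PRL] -/
theorem sum_inv_norm_sq_latticeShell_le (M : ℕ) :
    ∑ k ∈ ((Fintype.piFinset fun _ : Fin 3 => Finset.Icc (-((M : ℕ) : ℤ)) ((M : ℕ) : ℤ))).erase 0,
      1 / ‖(fun i => (k i : ℝ))‖ ^ 2 ≤ 26 * (M : ℝ) := by
  classical
  induction M with
  | zero =>
    rw [Finset.sum_eq_zero fun k hk => ?_]
    · simp
    · rw [Finset.mem_erase] at hk
      exact absurd (eq_zero_of_mem_latticeBox_zero hk.2) hk.1
  | succ M ih =>
    set s : Finset (Fin 3 → ℤ) := ((Fintype.piFinset fun _ : Fin 3 =>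
      Finset.Icc (-((M : ℕ) : ℤ)) ((M : ℕ) : ℤ))).erase 0 with hs
    set t : Finset (Fin 3 → ℤ) := ((Fintype.piFinset fun _ : Fin 3 =>
      Finset.Icc (-((M + 1 : ℕ) : ℤ)) ((M + 1 : ℕ) : ℤ))).erase 0 with ht
    have hsub : s ⊆ t := Finset.erase_subset_erase 0 (latticeBox_mono (Nat.le_succ M))
    rw [← Finset.sum_sdiff hsub]
    have hterm : ∀ k ∈ t \ s, 1 / ‖(fun i => (k i : ℝ))‖ ^ 2 ≤ 1 / ((M : ℝ) + 1) ^ 2 := by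
      intro k hk
      have hk' :
          k ∉ (Fintype.piFinset fun _ : Fin 3 => Finset.Icc (-((M : ℕ) : ℤ)) ((M : ℕ) : ℤ)) := by
        simp only [Finset.mem_sdiff, ht, hs, Finset.mem_erase] at hk
        exact fun h => hk.2 ⟨hk.1.1, h⟩
      have h1 := succ_le_norm_of_not_mem_latticeBox hk'
      exact one_div_le_one_div_of_le (by positivity) (by gcongr)
    have hcard : (((t \ s).card : ℕ) : ℝ) = (2 * (M + 1) + 1) ^ 3 - (2 * M + 1) ^ 3 := by
      have h1 := Finset.card_sdiff_add_card_eq_card hsub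
      have h2 : s.card + 1 = (2 * M + 1) ^ 3 := by
        rw [hs, Finset.card_erase_add_one (zero_mem_latticeBox M), card_latticeBox]
      have h3 : t.card + 1 = (2 * (M + 1) + 1) ^ 3 := by
        rw [ht, Finset.card_erase_add_one (zero_mem_latticeBox (M + 1)), card_latticeBox]
      have h4 : (t \ s).card + (2 * M + 1) ^ 3 = (2 * (M + 1) + 1) ^ 3 := by omega
      have h5 : (((t \ s).card : ℕ) : ℝ) + (2 * M + 1) ^ 3 = (2 * (M + 1) + 1) ^ 3 := by
        exact_mod_cast h4
      linarith
    have hshell : ∑ k ∈ t \ s, 1 / ‖(fun i => (k i : ℝ))‖ ^ 2 ≤ 26 := by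
      calc ∑ k ∈ t \ s, 1 / ‖(fun i => (k i : ℝ))‖ ^ 2 ≤ ∑ _k ∈ t \ s, 1 / ((M : ℝ) + 1) ^ 2 :=
            Finset.sum_le_sum hterm
        _ = ((2 * (M + 1) + 1) ^ 3 - (2 * M + 1) ^ 3) * (1 / ((M : ℝ) + 1) ^ 2) := by
            rw [Finset.sum_const, nsmul_eq_mul, hcard]
        _ = (24 * (M : ℝ) ^ 2 + 48 * M + 26) / ((M : ℝ) + 1) ^ 2 := by ring
        _ ≤ 26 := by
            rw [div_le_iff₀ (by positivity)]
            nlinarith [sq_nonneg (M : ℝ), (Nat.cast_nonneg M : (0 : ℝ) ≤ M)]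
    push_cast
    nlinarith [hshell, ih]

/-- VERBATIM COPY of `LaplacianModeCounting.condensate_ge_half_sq`
(`Theorems/BECLaplacianL1ModeCountingL1.lean`): mode counting on the torus from an exponent-2 infrared
bound, abstract per-state form. [cite: LSSY2005, §1.2 (1.17)–(1.19)] -/
theorem condensate_ge_half_sq {N : ℕ} {L K Cir : ℝ} (hL : 0 < L) (hK : 0 ≤ K) (hCir : 0 ≤ Cir)
    (v : ℝ → ℝ≥0∞) (Ψ : PeriodicTrialState N L) {D : ℝ≥0∞} (hD0 : D ≠ 0) (hDtop : D ≠ ⊤)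
    (hIR : ∀ k : Fin 3 → ℤ, k ≠ 0 → ‖(fun i => (k i : ℝ))‖ ≤ K →
      cellOccupation N L (planeWaveMode L k) Ψ.ψ ≤
        ENNReal.ofReal (Cir / ‖(fun i => (k i : ℝ))‖ ^ 2))
    (hUV : ∀ k : Fin 3 → ℤ, K < ‖(fun i => (k i : ℝ))‖ → D ≤ fracDispersion 2 L k)
    (hT : D⁻¹ * periodicEnergy v Ψ ≤ ENNReal.ofReal (N / 4))
    (hW : Cir * (26 * K) ≤ N / 4) :
    ENNReal.ofReal (1 / 2 * N) ≤ condensateOccupation N L Ψ.ψ := by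
  classical
  set n : (Fin 3 → ℤ) → ℝ≥0∞ := fun k => cellOccupation N L (planeWaveMode L k) Ψ.ψ with hn
  set M : ℕ := ⌊K⌋₊ with hM
  set S : Finset (Fin 3 → ℤ) :=
    ((Fintype.piFinset fun _ : Fin 3 => Finset.Icc (-((M : ℕ) : ℤ)) ((M : ℕ) : ℤ))).erase 0 with hS
  have hpt : ∀ k, n k ≤ (if k = 0 then n k else 0) +
      (if k ∈ S then ENNReal.ofReal (Cir / ‖(fun i => (k i : ℝ))‖ ^ 2) else 0) +
        D⁻¹ * (fracDispersion 2 L k * n k) := by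
    intro k
    by_cases hk0 : k = 0
    · rw [if_pos hk0]
      exact le_add_right (le_add_right le_rfl)
    · by_cases hkK : ‖(fun i => (k i : ℝ))‖ ≤ K
      · have hkS : k ∈ S := Finset.mem_erase.2 ⟨hk0, mem_latticeBox_floor_of_norm_le hkK⟩
        rw [if_neg hk0, if_pos hkS, zero_add]
        exact le_add_right (hIR k hk0 hkK)
      · push Not at hkK
        refine le_add_left ?_
        calc n k = D⁻¹ * D * n k := by rw [ENNReal.inv_mul_cancel hD0 hDtop, one_mul]
          _ ≤ D⁻¹ * fracDispersion 2 L k * n k := by gcongr; exact hUV k hkK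
          _ = D⁻¹ * (fracDispersion 2 L k * n k) := mul_assoc _ _ _
  have hIRsum :
      ∑ k ∈ S, ENNReal.ofReal (Cir / ‖(fun i => (k i : ℝ))‖ ^ 2) ≤ ENNReal.ofReal (N / 4) := by
    rw [← ENNReal.ofReal_sum_of_nonneg (fun k _ => by positivity)]
    refine ENNReal.ofReal_le_ofReal ?_
    calc ∑ k ∈ S, Cir / ‖(fun i => (k i : ℝ))‖ ^ 2
        = Cir * ∑ k ∈ S, 1 / ‖(fun i => (k i : ℝ))‖ ^ 2 := by
          rw [Finset.mul_sum]
          exact Finset.sum_congr rfl fun k _ => (mul_one_div _ _).symm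
      _ ≤ Cir * (26 * (M : ℝ)) := by gcongr; exact sum_inv_norm_sq_latticeShell_le M
      _ ≤ Cir * (26 * K) := by gcongr; exact Nat.floor_le hK
      _ ≤ N / 4 := hW
  have hTsum : D⁻¹ * ∑' k, fracDispersion 2 L k * n k ≤ ENNReal.ofReal (N / 4) := by
    refine le_trans ?_ hT
    gcongr
    calc ∑' k, fracDispersion 2 L k * n k = ∫⁻ X in cellN N L, kineticDensity Ψ.ψ X :=
          tsum_fracDispersion_two_mul_cellOccupation hL Ψ
      _ ≤ periodicEnergy v Ψ := lintegral_mono fun X => le_self_add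
  have hS' : ∑ k ∈ S, (if k ∈ S then ENNReal.ofReal (Cir / ‖(fun i => (k i : ℝ))‖ ^ 2) else 0) =
      ∑ k ∈ S, ENNReal.ofReal (Cir / ‖(fun i => (k i : ℝ))‖ ^ 2) :=
    Finset.sum_congr rfl fun k hk => if_pos hk
  have hsum : (N : ℝ≥0∞) ≤ n 0 + ENNReal.ofReal (N / 4) + ENNReal.ofReal (N / 4) := by
    calc (N : ℝ≥0∞) = ∑' k, n k := (Ψ.tsum_cellOccupation_planeWaveMode hL).symm
      _ ≤ ∑' k, ((if k = 0 then n k else 0) +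
          (if k ∈ S then ENNReal.ofReal (Cir / ‖(fun i => (k i : ℝ))‖ ^ 2) else 0) +
            D⁻¹ * (fracDispersion 2 L k * n k)) := ENNReal.tsum_le_tsum hpt
      _ = n 0 + ∑ k ∈ S, ENNReal.ofReal (Cir / ‖(fun i => (k i : ℝ))‖ ^ 2) +
          D⁻¹ * ∑' k, fracDispersion 2 L k * n k := by
          rw [ENNReal.tsum_add, ENNReal.tsum_add, tsum_ite_eq 0 n, ENNReal.tsum_mul_left,
            tsum_eq_sum (s := S) fun k hk => if_neg hk, hS']
      _ ≤ n 0 + ENNReal.ofReal (N / 4) + ENNReal.ofReal (N / 4) := by gcongr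
  have h2 : ENNReal.ofReal (1 / 2 * N) + ENNReal.ofReal (1 / 2 * N) = (N : ℝ≥0∞) := by
    rw [← ENNReal.ofReal_add (by positivity) (by positivity), ← ENNReal.ofReal_natCast]
    exact congrArg ENNReal.ofReal (by ring)
  have h4 : ENNReal.ofReal ((N : ℝ) / 4) + ENNReal.ofReal ((N : ℝ) / 4) =
      ENNReal.ofReal (1 / 2 * N) := by
    rw [← ENNReal.ofReal_add (by positivity) (by positivity)]
    exact congrArg ENNReal.ofReal (by ring)
  have hhalf : ENNReal.ofReal (1 / 2 * N) + ENNReal.ofReal (1 / 2 * N) ≤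
      n 0 + ENNReal.ofReal (1 / 2 * N) := by
    rw [h2, ← h4, ← add_assoc]
    exact hsum
  have h0 : n 0 = condensateOccupation N L Ψ.ψ := cellOccupation_planeWaveMode_zero N L Ψ.ψ
  rw [← h0]
  exact ENNReal.le_of_add_le_add_right ENNReal.ofReal_ne_top hhalf

/-- VERBATIM COPY of `cellOccupation_le_of_softening` (`Theorems/BECModePriceSofteningModeCount.lean`):
the chord `n_k(Ψ) ≤ (P + δ)L²/(2π²‖k‖_∞²)` from an SMS-shaped inequality at `(k, Ψ)` for a
`δ`-near-minimiser of a problem with `E₀ < ∞`. [cite: LSSY2005, §1.2 (1.17)–(1.19)] -/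
theorem cellOccupation_le_of_softening {N : ℕ} {L P δ : ℝ} (hL : 0 < L) (hP : 0 ≤ P) (hδ : 0 ≤ δ)
    (v : ℝ → ℝ≥0∞) (Ψ : PeriodicTrialState N L)
    (hE : periodicGroundStateEnergy v N L ≠ ⊤)
    (hΨ : periodicEnergy v Ψ ≤ periodicGroundStateEnergy v N L + ENNReal.ofReal δ)
    (k : Fin 3 → ℤ) (hk : k ≠ 0)
    (hSMS : periodicGroundStateEnergy v N L +
      2⁻¹ * fracDispersion 2 L k * cellOccupation N L (planeWaveMode L k) Ψ.ψ ≤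
        periodicEnergy v Ψ + ENNReal.ofReal P) :
    cellOccupation N L (planeWaveMode L k) Ψ.ψ ≤
      ENNReal.ofReal ((P + δ) * L ^ 2 / (2 * Real.pi ^ 2) / ‖(fun i => (k i : ℝ))‖ ^ 2) := by
  have hν : 0 < ‖(fun i => (k i : ℝ))‖ := by
    refine norm_pos_iff.2 fun h => hk (funext fun j => ?_)
    have := congrFun h j
    simpa using this
  have hsum : 0 < ∑ j, (k j : ℝ) ^ 2 := lt_of_lt_of_le (by positivity) (norm_sq_le_sum_sq k)
  have h1 : periodicGroundStateEnergy v N L +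
      2⁻¹ * fracDispersion 2 L k * cellOccupation N L (planeWaveMode L k) Ψ.ψ ≤
        periodicGroundStateEnergy v N L + ENNReal.ofReal (δ + P) := by
    calc periodicGroundStateEnergy v N L +
          2⁻¹ * fracDispersion 2 L k * cellOccupation N L (planeWaveMode L k) Ψ.ψ
        ≤ periodicEnergy v Ψ + ENNReal.ofReal P := hSMS
      _ ≤ periodicGroundStateEnergy v N L + ENNReal.ofReal δ + ENNReal.ofReal P := by gcongr
      _ = periodicGroundStateEnergy v N L + ENNReal.ofReal (δ + P) := by
          rw [add_assoc, ← ENNReal.ofReal_add hδ hP]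
  have h2 : 2⁻¹ * fracDispersion 2 L k * cellOccupation N L (planeWaveMode L k) Ψ.ψ ≤
      ENNReal.ofReal (δ + P) := (ENNReal.add_le_add_iff_left hE).1 h1
  have hpos : 0 < 2 * Real.pi ^ 2 * (∑ j, (k j : ℝ) ^ 2) / L ^ 2 := by positivity
  have hhalf : 2⁻¹ * fracDispersion 2 L k =
      ENNReal.ofReal (2 * Real.pi ^ 2 * (∑ j, (k j : ℝ) ^ 2) / L ^ 2) := by
    rw [fracDispersion_two, ← ENNReal.ofReal_ofNat 2, ← ENNReal.ofReal_inv_of_pos two_pos,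
      ← ENNReal.ofReal_mul (by norm_num)]
    exact congrArg ENNReal.ofReal (by ring)
  have hne0 : 2⁻¹ * fracDispersion 2 L k ≠ 0 := by
    rw [hhalf]
    exact (ENNReal.ofReal_pos.2 hpos).ne'
  have hnetop : 2⁻¹ * fracDispersion 2 L k ≠ ⊤ := by
    rw [hhalf]
    exact ENNReal.ofReal_ne_top
  calc cellOccupation N L (planeWaveMode L k) Ψ.ψ
      ≤ ENNReal.ofReal (δ + P) / (2⁻¹ * fracDispersion 2 L k) := by
        rw [ENNReal.le_div_iff_mul_le (Or.inl hne0) (Or.inl hnetop)]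
        calc cellOccupation N L (planeWaveMode L k) Ψ.ψ * (2⁻¹ * fracDispersion 2 L k)
            = 2⁻¹ * fracDispersion 2 L k * cellOccupation N L (planeWaveMode L k) Ψ.ψ :=
              mul_comm _ _
          _ ≤ ENNReal.ofReal (δ + P) := h2
    _ = ENNReal.ofReal ((δ + P) / (2 * Real.pi ^ 2 * (∑ j, (k j : ℝ) ^ 2) / L ^ 2)) := by
        rw [hhalf, ENNReal.ofReal_div_of_pos hpos]
    _ = ENNReal.ofReal ((P + δ) * L ^ 2 / (2 * Real.pi ^ 2) / ∑ j, (k j : ℝ) ^ 2) := by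
        congr 1
        field_simp
        ring
    _ ≤ ENNReal.ofReal ((P + δ) * L ^ 2 / (2 * Real.pi ^ 2) / ‖(fun i => (k i : ℝ))‖ ^ 2) := by
        refine ENNReal.ofReal_le_ofReal ?_
        exact div_le_div_of_nonneg_left (by positivity) (by positivity) (norm_sq_le_sum_sq k)

end Vendored

open Vendored

/-- Torus BEC of the `δ_N`-near-minimisers for the potential `v` — verbatim the hypothesis of the
route item `BoundaryTransferWeak` (and the conclusion of `SofteningModeCount`). -/
def TorusBEC (v : ℝ → ℝ≥0∞) : Prop :=
  ∃ ρ₀ : ℝ, 0 < ρ₀ ∧ ∀ ρ : ℝ, 0 < ρ → ρ < ρ₀ → ∃ c : ℝ, 0 < c ∧ ∀ᶠ N : ℕ in atTop,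
    ∃ δ : ℝ≥0∞, 0 < δ ∧ ∀ Ψ : PeriodicTrialState N (sideLength ρ N),
      periodicEnergy v Ψ ≤ periodicGroundStateEnergy v N (sideLength ρ N) + δ →
        ENNReal.ofReal (c * N) ≤ condensateOccupation N (sideLength ρ N) Ψ.ψ

/-- **The λ = 0 endpoint of SMS** (one-mode exponent-2 infrared bound for near-ground states, slack
chosen after `N`): `∃ C ρ₀, ∀ ρ < ρ₀, ∀ᶠ N, ∃ δ > 0, ∀ p ≠ 0, ∀ Ψ, ⟨Ψ,HΨ⟩ ≤ E₀ + δ →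
½|2πp/L|² n_p(Ψ) ≤ Cρ`. -/
def NearGroundStateModeBound : Prop :=
  ∀ v : ℝ → ℝ≥0∞, IsRepulsiveFiniteRange v →
    ∃ C : ℝ, 0 < C ∧ ∃ ρ₀ : ℝ, 0 < ρ₀ ∧ ∀ ρ : ℝ, 0 < ρ → ρ < ρ₀ →
      ∀ᶠ N : ℕ in atTop, ∃ δ : ℝ≥0∞, 0 < δ ∧ ∀ p : Fin 3 → ℤ, p ≠ 0 →
        ∀ Ψ : PeriodicTrialState N (sideLength ρ N),
          periodicEnergy v Ψ ≤ periodicGroundStateEnergy v N (sideLength ρ N) + δ →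
            2⁻¹ * fracDispersion 2 (sideLength ρ N) p *
                cellOccupation N (sideLength ρ N) (planeWaveMode (sideLength ρ N) p) Ψ.ψ ≤
              ENNReal.ofReal (C * ρ)

/-- The single-mode softening body of the route for one potential (common body of
`ModePriceIntegrable` / `ModePriceHardCore` / the first hypothesis of `SofteningModeCount`), written
with the Literature abbreviations `fracDispersion 2 L p = |2πp/L|²`, `planeWaveMode L p` (both `rfl`
to the inlined expressions). -/
def SMSBody (v : ℝ → ℝ≥0∞) : Prop :=
  ∃ C : ℝ, 0 < C ∧ ∃ ρ₀ : ℝ, 0 < ρ₀ ∧ ∀ ρ : ℝ, 0 < ρ → ρ < ρ₀ →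
    ∀ᶠ N : ℕ in atTop, ∀ p : Fin 3 → ℤ, p ≠ 0 → ∀ Ψ : PeriodicTrialState N (sideLength ρ N),
      periodicGroundStateEnergy v N (sideLength ρ N) +
          2⁻¹ * fracDispersion 2 (sideLength ρ N) p *
            cellOccupation N (sideLength ρ N) (planeWaveMode (sideLength ρ N) p) Ψ.ψ ≤
        periodicEnergy v Ψ + ENNReal.ofReal (C * ρ)

/-- The crux pair gives the SMS body for every admissible potential (case split on `∫ v`). -/
theorem smsBody_of_modePrice (h1 : ModePriceIntegrable) (h2 : ModePriceHardCore)
    (v : ℝ → ℝ≥0∞) (hv : IsRepulsiveFiniteRange v) : SMSBody v := by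
  by_cases h : (∫⁻ x : EuclideanSpace ℝ (Fin 3), v ‖x‖) = ⊤
  · obtain ⟨C, hC, ρ₀, hρ₀, hX⟩ := h2 v hv h
    exact ⟨C, hC, ρ₀, hρ₀, fun ρ hρ hρ₀' =>
      (hX ρ hρ hρ₀').mono fun N hN p hp Ψ => hN p hp Ψ⟩
  · obtain ⟨C, hC, ρ₀, hρ₀, hX⟩ := h1 v hv h
    exact ⟨C, hC, ρ₀, hρ₀, fun ρ hρ hρ₀' =>
      (hX ρ hρ hρ₀').mono fun N hN p hp Ψ => hN p hp Ψ⟩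

/-- **SMS ⇒ its λ = 0 endpoint** (slack `δ := Cρ`, constant `2C`; the finite ground-state energy
needed to cancel is supplied `∀ᶠ N` by the support `DiluteEnergyBound`, PROVED in
`Theorems/BECModePriceDiluteEnergyBound.lean` and taken as a hypothesis here, see §V). -/
theorem nearGroundStateModeBound_of_modePrice (h1 : ModePriceIntegrable) (h2 : ModePriceHardCore)
    (hE : DiluteEnergyBound) : NearGroundStateModeBound := by
  intro v hv
  obtain ⟨C, hC, ρX, hρX, hXv⟩ := smsBody_of_modePrice h1 h2 v hv
  obtain ⟨C', _hC', ρE, hρE, hEv⟩ := hE v hv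
  refine ⟨2 * C, by positivity, min ρX ρE, lt_min hρX hρE, fun ρ hρ hρ₀ => ?_⟩
  have hρX' : ρ < ρX := lt_of_lt_of_le hρ₀ (min_le_left _ _)
  have hρE' : ρ < ρE := lt_of_lt_of_le hρ₀ (min_le_right _ _)
  filter_upwards [hXv ρ hρ hρX', hEv ρ hρ hρE'] with N hXN hEN
  have hE0top : periodicGroundStateEnergy v N (sideLength ρ N) ≠ ⊤ :=
    ne_top_of_le_ne_top ENNReal.ofReal_ne_top hEN
  have hCρ : 0 ≤ C * ρ := by positivity
  refine ⟨ENNReal.ofReal (C * ρ), ENNReal.ofReal_pos.2 (by positivity), fun p hp Ψ hΨ => ?_⟩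
  set E₀ := periodicGroundStateEnergy v N (sideLength ρ N) with hE₀
  set X := 2⁻¹ * fracDispersion 2 (sideLength ρ N) p *
      cellOccupation N (sideLength ρ N) (planeWaveMode (sideLength ρ N) p) Ψ.ψ with hX
  have key : E₀ + X ≤ periodicEnergy v Ψ + ENNReal.ofReal (C * ρ) := hXN p hp Ψ
  have h1' : E₀ + X ≤ E₀ + (ENNReal.ofReal (C * ρ) + ENNReal.ofReal (C * ρ)) :=
    calc E₀ + X ≤ periodicEnergy v Ψ + ENNReal.ofReal (C * ρ) := key
      _ ≤ (E₀ + ENNReal.ofReal (C * ρ)) + ENNReal.ofReal (C * ρ) := by gcongr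
      _ = E₀ + (ENNReal.ofReal (C * ρ) + ENNReal.ofReal (C * ρ)) := add_assoc _ _ _
  calc X ≤ ENNReal.ofReal (C * ρ) + ENNReal.ofReal (C * ρ) := (ENNReal.add_le_add_iff_left hE0top).1 h1'
    _ = ENNReal.ofReal (2 * C * ρ) := by
        rw [← ENNReal.ofReal_add hCρ hCρ]
        exact congrArg ENNReal.ofReal (by ring)

/-- **Torus BEC from the λ = 0 endpoint alone, by the landed mode count.**  Same constants as
`softeningModeCount_proof` (`κ = √(C'+1)/π`, `K = κρ^{1/3}L`, `C_ir = (Cρ+δ_r)L²/(2π²)`,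
`δ_r = min(ρ, ρ^{2/3}N)`); the only change is the slack handed to `BoundaryTransferWeak`:
`δ := min(δ_r, δ_N)` with `δ_N` the endpoint's slack, so that the chord
(`cellOccupation_le_of_softening`, fed with `E₀ ≤ ⟨Ψ,HΨ⟩` and `½|k|²n_k(Ψ) ≤ Cρ`) applies to every
`δ`-near-minimiser at every window mode at once. -/
theorem torusBEC_of_nearGroundStateModeBound (hA : NearGroundStateModeBound) (hE : DiluteEnergyBound)
    (v : ℝ → ℝ≥0∞) (hv : IsRepulsiveFiniteRange v) : TorusBEC v := by
  obtain ⟨C, hC, ρX, hρX, hXv⟩ := hA v hv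
  obtain ⟨C', hC', ρE, hρE, hEv⟩ := hE v hv
  -- constants (verbatim from `softeningModeCount_proof`)
  set κ : ℝ := Real.sqrt (C' + 1) / Real.pi with hκ
  have hκ0 : 0 < κ := by positivity
  have hκ2 : Real.pi ^ 2 * κ ^ 2 = C' + 1 := by
    rw [hκ, div_pow, Real.sq_sqrt (by positivity)]
    field_simp
  set s₀ : ℝ := Real.pi ^ 2 / (52 * κ * (C + 1)) with hs₀
  have hs₀0 : 0 < s₀ := by positivity
  refine ⟨min (min ρX ρE) (s₀ ^ 3), lt_min (lt_min hρX hρE) (by positivity), fun ρ hρ hρ₀ => ?_⟩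
  have hρX' : ρ < ρX := lt_of_lt_of_le hρ₀ ((min_le_left _ _).trans (min_le_left _ _))
  have hρE' : ρ < ρE := lt_of_lt_of_le hρ₀ ((min_le_left _ _).trans (min_le_right _ _))
  have hρW : ρ < s₀ ^ 3 := lt_of_lt_of_le hρ₀ (min_le_right _ _)
  set s : ℝ := ρ ^ ((1 : ℝ) / 3) with hs
  have hs0 : 0 < s := Real.rpow_pos_of_pos hρ _
  have hs2 : ρ ^ ((2 : ℝ) / 3) = s ^ 2 := by
    rw [hs, show ((2 : ℝ) / 3) = (1 : ℝ) / 3 * 2 by norm_num, Real.rpow_mul hρ.le, Real.rpow_two]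
  have hs3 : s ^ 3 = ρ := by
    rw [hs, ← Real.rpow_natCast, ← Real.rpow_mul hρ.le]
    norm_num
  have hsW : s ≤ s₀ := by
    have h1 : s ≤ (s₀ ^ 3) ^ ((1 : ℝ) / 3) := Real.rpow_le_rpow hρ.le hρW.le (by norm_num)
    rwa [← Real.rpow_natCast, ← Real.rpow_mul hs₀0.le, show ((3 : ℕ) : ℝ) * ((1 : ℝ) / 3) = 1 by
      norm_num, Real.rpow_one] at h1
  refine ⟨1 / 2, by norm_num, ?_⟩
  filter_upwards [hXv ρ hρ hρX', hEv ρ hρ hρE', eventually_ge_atTop 1] with N hXN hEN hN1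
  obtain ⟨δA, hδA, hAN⟩ := hXN
  have hNr : (0 : ℝ) < N := Nat.cast_pos.2 hN1
  set L : ℝ := sideLength ρ N with hLdef
  have hL : 0 < L := Real.rpow_pos_of_pos (div_pos hNr hρ) _
  have hL3 : L ^ 3 = N / ρ := by
    rw [hLdef, sideLength, ← Real.rpow_natCast, ← Real.rpow_mul (div_pos hNr hρ).le]
    norm_num
  -- the slack: `min(δ_r, δ_N)`, `δ_r = min(ρ, s²N)` as in the count, `δ_N` from the endpoint
  set δr : ℝ := min ρ (s ^ 2 * N) with hδr
  have hδr0 : 0 < δr := lt_min hρ (by positivity)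
  refine ⟨min (ENNReal.ofReal δr) δA, lt_min (ENNReal.ofReal_pos.2 hδr0) hδA, ?_⟩
  intro Ψ hΨ
  have hΨr : periodicEnergy v Ψ ≤ periodicGroundStateEnergy v N L + ENNReal.ofReal δr :=
    hΨ.trans (add_le_add le_rfl (min_le_left _ _))
  have hΨA : periodicEnergy v Ψ ≤ periodicGroundStateEnergy v N L + δA :=
    hΨ.trans (add_le_add le_rfl (min_le_right _ _))
  have hE0top : periodicGroundStateEnergy v N L ≠ ⊤ := ne_top_of_le_ne_top ENNReal.ofReal_ne_top hEN
  have hΨE : periodicEnergy v Ψ ≤ ENNReal.ofReal ((C' + 1) * s ^ 2 * N) := by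
    calc periodicEnergy v Ψ ≤ periodicGroundStateEnergy v N L + ENNReal.ofReal (s ^ 2 * N) :=
          hΨr.trans (add_le_add le_rfl (ENNReal.ofReal_le_ofReal (min_le_right _ _)))
      _ ≤ ENNReal.ofReal (C' * ρ ^ ((2 : ℝ) / 3) * N) + ENNReal.ofReal (s ^ 2 * N) :=
          add_le_add hEN le_rfl
      _ = ENNReal.ofReal ((C' + 1) * s ^ 2 * N) := by
          rw [hs2, ← ENNReal.ofReal_add (by positivity) (by positivity)]
          exact congrArg ENNReal.ofReal (by ring)
  set D : ℝ≥0∞ := ENNReal.ofReal (4 * Real.pi ^ 2 * κ ^ 2 * s ^ 2) with hD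
  have hDpos : 0 < 4 * Real.pi ^ 2 * κ ^ 2 * s ^ 2 := by positivity
  have hD0 : D ≠ 0 := (ENNReal.ofReal_pos.2 hDpos).ne'
  refine condensate_ge_half_sq hL (K := κ * s * L)
    (Cir := (C * ρ + δr) * L ^ 2 / (2 * Real.pi ^ 2)) (by positivity) (by positivity) v Ψ hD0
    ENNReal.ofReal_ne_top ?_ ?_ ?_ ?_
  · -- (IR) the endpoint bound at `(k, Ψ)` plus `E₀ ≤ ⟨Ψ,HΨ⟩` is an SMS-shaped inequality; chord.
    intro k hk0 _hkK
    have hAk : 2⁻¹ * fracDispersion 2 L k * cellOccupation N L (planeWaveMode L k) Ψ.ψ ≤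
        ENNReal.ofReal (C * ρ) := hAN k hk0 Ψ hΨA
    have hSMS : periodicGroundStateEnergy v N L +
        2⁻¹ * fracDispersion 2 L k * cellOccupation N L (planeWaveMode L k) Ψ.ψ ≤
          periodicEnergy v Ψ + ENNReal.ofReal (C * ρ) :=
      add_le_add (periodicGroundStateEnergy_le v Ψ) hAk
    exact cellOccupation_le_of_softening hL (by positivity) hδr0.le v Ψ hE0top hΨr k hk0 hSMS
  · -- (UV) verbatim
    intro k hk
    rw [hD, fracDispersion_two]
    refine ENNReal.ofReal_le_ofReal ?_
    have h1 : (κ * s * L) ^ 2 < ∑ j, (k j : ℝ) ^ 2 := by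
      calc (κ * s * L) ^ 2 < ‖(fun i => (k i : ℝ))‖ ^ 2 := by gcongr
        _ ≤ ∑ j, (k j : ℝ) ^ 2 := norm_sq_le_sum_sq k
    rw [mul_pow, mul_pow] at h1
    rw [le_div_iff₀ (by positivity)]
    calc 4 * Real.pi ^ 2 * κ ^ 2 * s ^ 2 * L ^ 2 = 4 * Real.pi ^ 2 * (κ ^ 2 * s ^ 2 * L ^ 2) := by
          ring
      _ ≤ 4 * Real.pi ^ 2 * ∑ j, (k j : ℝ) ^ 2 := by gcongr
  · -- (T) verbatim
    calc D⁻¹ * periodicEnergy v Ψ ≤ D⁻¹ * ENNReal.ofReal ((C' + 1) * s ^ 2 * N) := by gcongr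
      _ = ENNReal.ofReal ((C' + 1) * s ^ 2 * N / (4 * Real.pi ^ 2 * κ ^ 2 * s ^ 2)) := by
          rw [← ENNReal.div_eq_inv_mul, hD, ← ENNReal.ofReal_div_of_pos hDpos]
      _ = ENNReal.ofReal (N / 4) := by
          congr 1
          rw [show 4 * Real.pi ^ 2 * κ ^ 2 * s ^ 2 = 4 * (Real.pi ^ 2 * κ ^ 2) * s ^ 2 by ring, hκ2]
          field_simp
  · -- (window) verbatim
    have hδρ : C * ρ + δr ≤ (C + 1) * ρ := by
      have := min_le_left ρ (s ^ 2 * N)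
      linarith
    have hkey : 13 * κ * s * (C + 1) ≤ Real.pi ^ 2 / 4 := by
      have h1 : s * (52 * κ * (C + 1)) ≤ Real.pi ^ 2 := by
        rw [← le_div_iff₀ (by positivity)]
        exact hsW
      linarith
    calc (C * ρ + δr) * L ^ 2 / (2 * Real.pi ^ 2) * (26 * (κ * s * L))
        = 13 * κ * s * (C * ρ + δr) * L ^ 3 / Real.pi ^ 2 := by ring
      _ = 13 * κ * s * (C * ρ + δr) * (N / ρ) / Real.pi ^ 2 := by rw [hL3]
      _ ≤ 13 * κ * s * ((C + 1) * ρ) * (N / ρ) / Real.pi ^ 2 := by gcongr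
      _ = 13 * κ * s * (C + 1) * N / Real.pi ^ 2 := by
          field_simp
      _ ≤ Real.pi ^ 2 / 4 * N / Real.pi ^ 2 := by gcongr
      _ = N / 4 := by
          field_simp

/-- **Re-glue**: the route's conclusion from the λ = 0 endpoint, the proved dilute energy bound and
the shared boundary-condition transfer — the two open `ModePrice*` cruxes enter the summit conjunct
only through `NearGroundStateModeBound`. -/
theorem closes_of_nearGroundStateModeBound :
    NearGroundStateModeBound → DiluteEnergyBound → BoundaryTransferWeak →
      _root_.BoseEinsteinCondensation :=
  fun hA hE hBT v hv => hBT v hv (torusBEC_of_nearGroundStateModeBound hA hE v hv)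

/-- Sanity: the original deciding chain factors through the endpoint (same binders as the route's
`closes` minus `SofteningModeCount`). -/
example (h1 : ModePriceIntegrable) (h2 : ModePriceHardCore) (hE : DiluteEnergyBound)
    (hBT : BoundaryTransferWeak) : _root_.BoseEinsteinCondensation :=
  closes_of_nearGroundStateModeBound (nearGroundStateModeBound_of_modePrice h1 h2 hE) hE hBT

end Summit.AtomisticToContinuum.BoseEinsteinCondensation.Cruxes.ModePriceHardCore.IdeatorK5g6

end
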